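import Mathlib.NumberTheory.Zsqrtd.Basic
import Mathlib.RingTheory.Coprime.Lemmas
import Mathlib.Data.Finset.Basic
import Mathlib.Tactic.Ring
import Mathlib.Tactic.Linarith
import Mathlib.Tactic.NormNum
import Mathlib.Tactic.LinearCombination
import HarnessLib

/-!
# Venture HSemireg — THEOREM LINE-DIOPHANTINE, direction (iii) ⇒ (ii) (ENGINE-W PROBE5 §14): a primitive representation
# `c = x² − m·y²` gives a COMMON TWIST `A` with `z = x + y·l ∣ A − l` in `ℤ[√m]` — the explicit quotient — plus the remaining imaginary
# line tables of COROLLARY (b) (`ℚ(√−5), ℚ(√−6), ℚ(√−10), ℚ(√−11), ℚ(√−13), ℚ(√−14), ℚ(√−15), ℚ(√−31)`, `2 ≤ c ≤ 48`) — kernel arithmetic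

HONEST FRAMING. Lean index of the computation cell `pub-hsemireg`, widening group ENGINE-W (code A, seat `engine-w-1`, gen 18).
ELEMENTARY ARITHMETIC IN `ℤ√m` (Mathlib's `Zsqrtd`) AND BOUNDED SEARCHES ONLY; no abelian variety, sheaf, `Ext` group, secant structure,
autoequivalence or semiregularity map is constructed; nothing here says that HC, HC_CM or HC_AV holds. Theorems only (0 `def`, 0 named
fact, 0 `sorry`). New namespace `LineTwist`. Companion of `LineDiophantineArithmetic.lean` (transport formula; tables for `ℚ(i)`, `ℚ(√−2)`,
`ℚ(√−7)`; `repr_bounds` = completeness of the bounded search `x ≤ 6`, `n·y² ≤ 48`) and `R1DiophantinePellTwo.lean` (`c = 2`).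

SOURCE (the cell's own result, by value): `widen/ENGINE-W/out/probe5/PROBE5-STIZ-A.md` §14 THEOREM LINE-DIOPHANTINE, proof of
(iii) ⇒ (ii): «CF⁶ with z = x + y·l (N(z) = c > 0, primitive) …; a common A with z ∣ A − l exists: gcd(y, c) = 1 (a prime dividing y and
c = x² − my² would divide x), so with y·y′ ≡ 1 (mod c) and c = z·z^σ ∈ (z): y·l ≡ −x (mod z) gives l ≡ −y′x (mod z) — take A := −y′x»,
and COROLLARY (b) TABLE (`linerep.A.json 4cf7c4989ac082b3`). What the kernel holds:

* §1 **`isCoprime_weight`**: `x, y` coprime ⟹ `y` and `c = x² − m·y²` coprime (the printed gcd remark).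
* §2 **the explicit quotient**: with `c = x² − m·y²` and a Bézout relation `y·y′ = 1 + c·k`, in `ℤ√m`
  `(x + y·l)·((−y′ − m·y·k) + (x·k)·l) = (−y′x) − l` (`quotient_identity`, checked componentwise by `ring`); hence
  `dvd_common_twist` (`x + y·l ∣ A − l` with `A = −y′·x`) and **`exists_common_twist`** (`x, y` coprime ⟹ `∃ A, x + y·l ∣ A − l`);
  the `y = 1` case `dvd_twist_y_one` (`A = −x`, quotient `−1`: all seven explicit lines of COROLLARY (c) — `3+√3`, `1+√−5`, `1+√−13`,
  `1+√−6`, `3+√5`, `2+√−7`, `4+√11` — have `y = 1`); `norm_eq_weight` (`N(x + y·l) = x² − m·y²`).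
* §3 **COROLLARY (b)'s imaginary line tables** not yet in the tree, each «`c ∈ [2,48]` is primitively represented by `x² + n·y²` iff `c` is
  in the printed set» by `decide` over the complete box (`x ≤ 6`, `n·y² ≤ 48`): `lineTable_5` {5,6,9,14,21,29,30,41,45,46},
  `lineTable_6` {6,7,10,15,22,25,31,33,42}, `lineTable_10` {10,11,14,19,26,35,41,46}, `lineTable_11` (the `ℤ[√−11]`-seed)
  {11,12,15,20,27,36,45,47}, `lineTable_13` {13,14,17,22,29,38}, `lineTable_14` {14,15,18,23,30,39}, `lineTable_15` (the `ℤ[√−15]`-seed)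
  {15,16,19,24,31,40}, `lineTable_31` (the `ℤ[√−31]`-seed) {31,32,35,40,47}.
-/

namespace Summit.Ventures.HSemireg.LineTwist

/-! ## §1 The weight is prime to `y` -/

/-- **gcd remark**: if `x, y` are coprime then `y` is prime to `c = x² − m·y²` («a prime dividing y and c would divide x»). [kernel] -/
theorem isCoprime_weight {x y : ℤ} (m : ℤ) (h : IsCoprime x y) : IsCoprime y (x ^ 2 - m * y ^ 2) := by
  have h2 : IsCoprime y (x ^ 2) := IsCoprime.pow_right h.symm
  have e : x ^ 2 - m * y ^ 2 = x ^ 2 + y * (-(m * y)) := by ring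
  rw [e]
  exact h2.add_mul_left_right _

/-! ## §2 The explicit quotient and the common twist -/

/-- **The explicit quotient**: if `c = x² − m·y²` and `y·y′ = 1 + c·k`, then in `ℤ√m`
`(x + y·l)·((−y′ − m·y·k) + (x·k)·l) = −y′·x − l`. (Real part: `x(−y′ − myk) + m·y·(xk) = −y′x`; `l`-part:
`x·(xk) + y·(−y′ − myk) = c·k − y·y′ = −1`.) [kernel, componentwise `ring`] -/
theorem quotient_identity {m x y y' c k : ℤ} (hc : c = x ^ 2 - m * y ^ 2) (hk : y * y' = 1 + c * k) :
    (⟨x, y⟩ : ℤ√m) * ⟨-y' - m * y * k, x * k⟩ = ⟨-(y' * x), -1⟩ := by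
  ext
  · simp only [Zsqrtd.re_mul]
    ring
  · simp only [Zsqrtd.im_mul]
    linear_combination (-k) * hc - hk

/-- Hence **`z = x + y·l` divides `A − l` for `A := −y′·x`** (`y′` an inverse of `y` modulo `c`). [kernel] -/
theorem dvd_common_twist {m x y y' c k : ℤ} (hc : c = x ^ 2 - m * y ^ 2) (hk : y * y' = 1 + c * k) :
    (⟨x, y⟩ : ℤ√m) ∣ ⟨-(y' * x), -1⟩ :=
  ⟨⟨-y' - m * y * k, x * k⟩, (quotient_identity hc hk).symm⟩

/-- **A common twist exists** (direction (iii) ⇒ (ii) of THEOREM LINE-DIOPHANTINE, arithmetic part): if `x, y` are coprime then some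
integer `A` has `x + y·l ∣ A − l` in `ℤ√m` (Bézout for `y` and `c = x² − m·y²`, then `A = −y′x`). [kernel] -/
theorem exists_common_twist {x y : ℤ} (m : ℤ) (h : IsCoprime x y) : ∃ A : ℤ, (⟨x, y⟩ : ℤ√m) ∣ ⟨A, -1⟩ := by
  obtain ⟨u, v, huv⟩ := isCoprime_weight m h
  -- `u·y + v·c = 1`, i.e. `y·u = 1 + c·(−v)`
  refine ⟨-(u * x), dvd_common_twist (c := x ^ 2 - m * y ^ 2) (k := -v) rfl ?_⟩
  linear_combination huv

/-- The **`y = 1` case** (all seven explicit lines of COROLLARY (c): `z = x + l`, `A = −x`): `(x + l)·(−1) = −x − l`. [kernel] -/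
theorem dvd_twist_y_one (m x : ℤ) : (⟨x, 1⟩ : ℤ√m) ∣ ⟨-x, -1⟩ :=
  ⟨-1, by ext <;> simp⟩

/-- The norm of the transporting element is the weight: `N(x + y·l) = x² − m·y²`. [kernel] -/
theorem norm_eq_weight (m x y : ℤ) : (⟨x, y⟩ : ℤ√m).norm = x ^ 2 - m * y ^ 2 := by
  rw [Zsqrtd.norm_def]
  ring

/-! ## §3 COROLLARY (b): the remaining imaginary line tables (`2 ≤ c ≤ 48`) -/

/-- **Line table for `ℚ(√−5)`** (card §14 (b): {5,6,9,14,21,29,30,41,45,46}): `c ∈ [2,48]` is primitively represented by `x² + 5y²`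
exactly for the listed `c` (complete box `x ≤ 6`, `y ≤ 3`). [kernel, `decide`] -/
theorem lineTable_5 :
    ∀ c ∈ Finset.Icc 2 48,
      (c ∈ ({5, 6, 9, 14, 21, 29, 30, 41, 45, 46} : Finset ℕ) ↔
        ∃ x ∈ Finset.range 7, ∃ y ∈ Finset.range 4, x ^ 2 + 5 * y ^ 2 = c ∧ Nat.gcd x y = 1) := by
  decide

/-- **Line table for `ℚ(√−6)`** (card: {6,7,10,15,22,25,31,33,42}); box `x ≤ 6`, `y ≤ 2`. [kernel, `decide`] -/
theorem lineTable_6 :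
    ∀ c ∈ Finset.Icc 2 48,
      (c ∈ ({6, 7, 10, 15, 22, 25, 31, 33, 42} : Finset ℕ) ↔
        ∃ x ∈ Finset.range 7, ∃ y ∈ Finset.range 3, x ^ 2 + 6 * y ^ 2 = c ∧ Nat.gcd x y = 1) := by
  decide

/-- **Line table for `ℚ(√−10)`** (card: {10,11,14,19,26,35,41,46}); box `x ≤ 6`, `y ≤ 2`. [kernel, `decide`] -/
theorem lineTable_10 :
    ∀ c ∈ Finset.Icc 2 48,
      (c ∈ ({10, 11, 14, 19, 26, 35, 41, 46} : Finset ℕ) ↔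
        ∃ x ∈ Finset.range 7, ∃ y ∈ Finset.range 3, x ^ 2 + 10 * y ^ 2 = c ∧ Nat.gcd x y = 1) := by
  decide

/-- **Line table for `ℚ(√−11)`, `ℤ[√−11]`-seed** (card: {11,12,15,20,27,36,45,47}); box `x ≤ 6`, `y ≤ 2`. [kernel, `decide`] -/
theorem lineTable_11 :
    ∀ c ∈ Finset.Icc 2 48,
      (c ∈ ({11, 12, 15, 20, 27, 36, 45, 47} : Finset ℕ) ↔
        ∃ x ∈ Finset.range 7, ∃ y ∈ Finset.range 3, x ^ 2 + 11 * y ^ 2 = c ∧ Nat.gcd x y = 1) := by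
  decide

/-- **Line table for `ℚ(√−13)`** (card: {13,14,17,22,29,38}); box `x ≤ 6`, `y ≤ 1`. [kernel, `decide`] -/
theorem lineTable_13 :
    ∀ c ∈ Finset.Icc 2 48,
      (c ∈ ({13, 14, 17, 22, 29, 38} : Finset ℕ) ↔
        ∃ x ∈ Finset.range 7, ∃ y ∈ Finset.range 2, x ^ 2 + 13 * y ^ 2 = c ∧ Nat.gcd x y = 1) := by
  decide

/-- **Line table for `ℚ(√−14)`** (card: {14,15,18,23,30,39}); box `x ≤ 6`, `y ≤ 1`. [kernel, `decide`] -/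
theorem lineTable_14 :
    ∀ c ∈ Finset.Icc 2 48,
      (c ∈ ({14, 15, 18, 23, 30, 39} : Finset ℕ) ↔
        ∃ x ∈ Finset.range 7, ∃ y ∈ Finset.range 2, x ^ 2 + 14 * y ^ 2 = c ∧ Nat.gcd x y = 1) := by
  decide

/-- **Line table for `ℚ(√−15)`, `ℤ[√−15]`-seed** (card: {15,16,19,24,31,40}); box `x ≤ 6`, `y ≤ 1`. [kernel, `decide`] -/
theorem lineTable_15 :
    ∀ c ∈ Finset.Icc 2 48,
      (c ∈ ({15, 16, 19, 24, 31, 40} : Finset ℕ) ↔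
        ∃ x ∈ Finset.range 7, ∃ y ∈ Finset.range 2, x ^ 2 + 15 * y ^ 2 = c ∧ Nat.gcd x y = 1) := by
  decide

/-- **Line table for `ℚ(√−31)`, `ℤ[√−31]`-seed** (card: {31,32,35,40,47}); box `x ≤ 6`, `y ≤ 1`. [kernel, `decide`] -/
theorem lineTable_31 :
    ∀ c ∈ Finset.Icc 2 48,
      (c ∈ ({31, 32, 35, 40, 47} : Finset ℕ) ↔
        ∃ x ∈ Finset.range 7, ∃ y ∈ Finset.range 2, x ^ 2 + 31 * y ^ 2 = c ∧ Nat.gcd x y = 1) := by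
  decide

/-- The boxes are complete (as `LineDiophantine.repr_bounds`, restated for the `y`-bounds used here): `x² + n y² = c ≤ 48` with
`n ≥ 5` forces `y ≤ 3`, with `n ≥ 6` forces `y ≤ 2`, with `n ≥ 13` forces `y ≤ 1`. [kernel] -/
theorem y_bounds (n c x y : ℕ) (hc : c ≤ 48) (h : x ^ 2 + n * y ^ 2 = c) :
    (5 ≤ n → y ≤ 3) ∧ (6 ≤ n → y ≤ 2) ∧ (13 ≤ n → y ≤ 1) := by
  refine ⟨fun hn => ?_, fun hn => ?_, fun hn => ?_⟩
  · by_contra hy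
    push Not at hy
    have : 16 ≤ y ^ 2 := by nlinarith
    nlinarith
  · by_contra hy
    push Not at hy
    have : 9 ≤ y ^ 2 := by nlinarith
    nlinarith
  · by_contra hy
    push Not at hy
    have : 4 ≤ y ^ 2 := by nlinarith
    nlinarith

end Summit.Ventures.HSemireg.LineTwist
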